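import Literature.MathematicalPhysics.QuantumFieldTheory.Balaban1985CMP102.SectA
import Summits.QuantumFields.Balaban3D.Carriers.Run
import Summits.QuantumFields.Balaban3D.Carriers.Formula10

/-!
# Lane `pub-balaban3d` — carrier layer p1, part 6 (`Carriers.Eq10Run3`): display **(10)** p. 258 of [Balaban1985UV3] BY NAME for the
# constructed run — `SectA.Eq10 (run3 I) s ζχ (fun i => radialBonds (Ω₁ i))` (design decision D-1b CLOSED as a theorem)

The spine's `…Balaban1985CMP102.SectA.Eq10` (typer-1, statement = ruling R-EQ10′) is the push-forward reading of
«(Tρ₀)(V) = Σ_{Ω₁} ∫dU δ(ŪV^{−1}) δ_{Ax(Ω₁)}(U) ζ_{Ω₁ᶜ} χ_{Ω₁} exp[−(1/g₀²)A(U) − E]» (p. 258 = PDF 4 L14–19).  For `run3` it is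
`Carriers.Formula10.formula10_sum` instantiated at `ρ := ρ₀` (gauge invariant: the Wilson action is a class function of the
plaquette variables), `ρ' := ρ₁ = Tρ₀` (`run3_isRT I 0`) and the radial forests of the blocks of the regions `Ω₁ i` (ONE axial
gauge, ruling R-FOREST: `Ax i := radialBonds (Ω₁ i)` = the bond set of the contours Γ_{y,x} of (9), [Balaban1984PropagatorsI] (1.7)).
Remaining hypotheses are STRUCTURAL only (standing range; the weights `ζχ i` of (8) measurable, gauge invariant, `|·| ≤ 1`, summing
to `1` — LQB `B10Decomposition7.resummation8_printed_indicator` / p4's `Decomposition8.sum_weight8_eq_one`).  [folklore] measure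
theory; nothing of CMP 102 is asserted beyond the identity proved.
-/

open MeasureTheory

namespace Summit.QuantumFields.Balaban3D.Carriers

open Literature.MathematicalPhysics.QuantumFieldTheory.Balaban1983to89
open Literature.MathematicalPhysics.QuantumFieldTheory.Balaban1985CMP102
open Literature.MathematicalPhysics.QuantumFieldTheory.Balaban1985CMP102.Setting

variable {L : ℕ} {S : Scales L} {G : Type} [GaugeGroup G] [MeasurableSpace G] [HaarData G]

omit [MeasurableSpace G] [HaarData G] in
/-- The Wilson start `ρ₀ = exp[−(1/g₀²)A(U) − E]` of (1) is GAUGE INVARIANT (`Re tr` is a class function: `GaugeGroup.reTr_conj`).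
[cite: Balaban1985UV3, (1) p.256] -/
theorem gaugeInvariant_wilsonStart (P : Params) (g0sq E : ℝ) :
    GaugeField.GaugeInvariant (wilsonStart P G g0sq E) := by
  intro u U
  unfold wilsonStart wilsonAction4 wilsonAction
  simp only [T4ReTrLipUnitary.plaqHol_gaugeAct, GaugeGroup.reTr_conj]

open Classical in
/-- **(10) p. 258 FOR THE CONSTRUCTED RUN, BY NAME** (D-1b): the spine's `SectA.Eq10` holds for `run3 I` with the radial axial
forests of the regions `Ω₁ i` as the gauge-fixing bond sets, for ANY finite family of gauge-invariant measurable weights `ζχ i`,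
`|ζχ i| ≤ 1`, `Σ_i ζχ i = 1` (print's: the (8)-weights `ζ_{Ω₁ᶜ}χ_{Ω₁}` over the admissible regions `Ω₁`).  Standing range
`1 ≤ m + K`; regular gauge group (every group as printed: `Carriers.Group.groupModel_regularGaugeGroup`). [cite: Balaban1985UV3, (10) p.258] -/
theorem eq10_run3 [RegularGaugeGroup G] (I : RunInput S G) (hm : 1 ≤ S.P.m + S.P.K) {ι : Type} (s : Finset ι)
    (Ω₁ : ι → Finset (Site S.P 1)) (ζχ : ι → Density S.P 0 G) (hwm : ∀ i ∈ s, Measurable (ζχ i))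
    (hwinv : ∀ i ∈ s, GaugeField.GaugeInvariant (ζχ i)) (hwb : ∀ i ∈ s, ∀ U, |ζχ i U| ≤ 1)
    (hws : ∀ U, ∑ i ∈ s, ζχ i U = 1) :
    SectA.Eq10 (run3 I) s ζχ (fun i => radialBonds (Ω₁ i)) := by
  intro f hf hfC
  exact formula10_sum (P := S.P) (j := 0) hm s Ω₁ ζχ hwm hwinv hwb hws (I.av 0) (I.avgAC 0).measurable
    (measurable_wilsonStart S.g0sq I.E) (gaugeInvariant_wilsonStart S.P S.g0sq I.E)
    (integrable_wilsonStart (g0sq_nonneg S) I.E) (run3_isRT I 0) f hf hfC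

end Summit.QuantumFields.Balaban3D.Carriers
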